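import Literature.AlgebraicGeometry.Resolution.MarkedIdealsLemmas
import HarnessLib

/-!
# Two morphisms agree on a closed subscheme `V(J)` when they agree modulo `J` on sections (Kollár 2007, Def. 3.91 (4′) / Def. 3.96 (2))

Topic: `Literature/AlgebraicGeometry/Resolution`. Plumbing on the line discharging the named
fact `Kollar2007Thm3_103` (`KollarBlowupSequenceFunctors.lean`; J. Kollár, *Lectures on
Resolution of Singularities*, 2007) through 3.104 Step 2.3 (Thms. 3.92 and 3.97). Kollár's
étale equivalence asks, besides `ψ^*I = ψ'^*I`, for (Def. 3.91 (4′), p. 162 of the held copy;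
Def. 3.96 (2), p. 165) "`ψ^*(h) - ψ'^*(h) ∈ MC(ψ^*(I))` for every `h ∈ 𝒪_X`" — a CONGRUENCE of
the two pull-back maps modulo an ideal. The tree proves Thm. 3.92 in a stalkwise form
(`KollarEtaleNeighbourhood.lean`: "`ψ^*(h) - ψ'^*(h) ∈ (ψ'^*B)_u` for all global `h`") and uses
it in Thm. 3.97 in the scheme-theoretic form "`ψ` and `ψ'` agree on the closed subscheme
`V(J)`" (`J.subschemeι ≫ ψ = J.subschemeι ≫ ψ'`, `KollarEtaleEquivalentSequences.lean`,
`BlowupLiftsCongruence.lean`). This file PROVES the passage from the former to the latter: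

* `mem_ideal_of_forall_germ_mem` — membership of a section in a quasi-coherent ideal sheaf is
  local on stalks (`Ideal.mem_of_localization_maximal`, the stalks being the localizations of
  the affine coordinate ring); `appLE_sub_appLE_mem_of_forall_germ` — hence stalkwise
  congruences `(ψ^*s - ψ'^*s)_u ∈ J_u` give `ψ^*s - ψ'^*s ∈ J(W)`;
* `ι_subschemeι_comp_eq_of_forall_sub_mem` — **if `ψ, ψ'` map an affine open `W ⊆ U` into a
  common affine open `V ⊆ X` and `ψ^*s - ψ'^*s ∈ J(W)` for all `s ∈ Γ(X, V)`, then `ψ` and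
  `ψ'` agree on the open part `V(J) ∩ W` of `V(J)`** (morphisms to the affine `V` are
  determined by global sections, `ext_of_isAffine`, and the kernel of `Γ(U, W) → Γ(V(J), …)`
  is `J(W)`, `Scheme.IdealSheafData.ker_subschemeι_app`);
* **`subschemeι_comp_eq_of_forall_sub_mem`** — the global form: such charts around every point
  give `J.subschemeι ≫ ψ = J.subschemeι ≫ ψ'` (`Scheme.hom_ext_of_forall`).

No definitions, no named fact.

## Sources

* J. Kollár, *Lectures on Resolution of Singularities*, Ann. of Math. Stud. 166, PUP 2007:
  Def. 3.91 (4′) (p. 162), Def. 3.96 (2) (p. 165), 3.95 (pp. 164–165) of the held copy.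
  [Kollar2007]
-/

noncomputable section

open CategoryTheory AlgebraicGeometry TopologicalSpace

namespace Literature.AlgebraicGeometry.Resolution

universe u

variable {U X : Scheme.{u}} (J : U.IdealSheafData) {ψ ψ' : U ⟶ X}

/-- Elementwise composition of `appLE` (local copy). [folklore] -/
private theorem appLE_appLE_apply' {X Y Z : Scheme.{u}} (f : X ⟶ Y) (g : Y ⟶ Z) (U : Z.Opens)
    (V : Y.Opens) (W : X.Opens) (e₁ : V ≤ g ⁻¹ᵁ U) (e₂ : W ≤ f ⁻¹ᵁ V) (s : Γ(Z, U)) :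
    f.appLE V W e₂ (g.appLE U V e₁ s) =
      (f ≫ g).appLE U W (e₂.trans ((Opens.map f.base).map (homOfLE e₁)).le) s := by
  rw [← CommRingCat.comp_apply, Scheme.Hom.appLE_comp_appLE]

/-- **Agreement on `V(J)` over an affine chart, from congruences of sections**: if `ψ` and `ψ'`
map the affine open `W ⊆ U` into the affine open `V ⊆ X` and `ψ^*s - ψ'^*s ∈ J(W)` for every
`s ∈ Γ(X, V)`, then `ψ` and `ψ'` agree on the open part `V(J) ∩ W` of the closed subscheme
`V(J)` — the scheme-theoretic content of Kollár's "`ψ^*(h) - ψ'^*(h) ∈ MC(ψ^*(I))` for every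
`h ∈ 𝒪_X`" (Def. 3.91 (4′), Def. 3.96 (2)). [cite: Kollar2007, Def. 3.91 (4′) (p. 162), Def. 3.96 (2) (p. 165)] -/
theorem ι_subschemeι_comp_eq_of_forall_sub_mem (V : X.affineOpens) (W : U.affineOpens)
    (hW : (W : U.Opens) ≤ ψ ⁻¹ᵁ (V : X.Opens)) (hW' : (W : U.Opens) ≤ ψ' ⁻¹ᵁ (V : X.Opens))
    (h : ∀ s : Γ(X, V), ψ.appLE V W hW s - ψ'.appLE V W hW' s ∈ J.ideal W) :
    (J.subschemeι ⁻¹ᵁ (W : U.Opens)).ι ≫ J.subschemeι ≫ ψ =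
      (J.subschemeι ⁻¹ᵁ (W : U.Opens)).ι ≫ J.subschemeι ≫ ψ' := by
  have hS : J.subschemeι ⁻¹ᵁ (W : U.Opens) ≤ (J.subschemeι ≫ ψ) ⁻¹ᵁ (V : X.Opens) :=
    fun z hz => hW hz
  have hS' : J.subschemeι ⁻¹ᵁ (W : U.Opens) ≤ (J.subschemeι ≫ ψ') ⁻¹ᵁ (V : X.Opens) :=
    fun z hz => hW' hz
  haveI : IsAffine (V : X.Opens) := V.2
  have e1 : ∀ φ : Γ(X, V), (J.subschemeι ≫ ψ).appLE V (J.subschemeι ⁻¹ᵁ (W : U.Opens)) hS φ =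
      J.subschemeι.app W (ψ.appLE V W hW φ) := fun φ => by
    rw [Scheme.Hom.app_eq_appLE, appLE_appLE_apply']
  have e2 : ∀ φ : Γ(X, V), (J.subschemeι ≫ ψ').appLE V (J.subschemeι ⁻¹ᵁ (W : U.Opens)) hS' φ =
      J.subschemeι.app W (ψ'.appLE V W hW' φ) := fun φ => by
    rw [Scheme.Hom.app_eq_appLE, appLE_appLE_apply']
  have happ : (J.subschemeι ≫ ψ).appLE V (J.subschemeι ⁻¹ᵁ (W : U.Opens)) hS =
      (J.subschemeι ≫ ψ').appLE V (J.subschemeι ⁻¹ᵁ (W : U.Opens)) hS' := by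
    ext φ
    rw [e1, e2, ← sub_eq_zero, ← map_sub, ← RingHom.mem_ker,
      Scheme.IdealSheafData.ker_subschemeι_app]
    exact h φ
  have key : (J.subschemeι ≫ ψ).resLE V _ hS = (J.subschemeι ≫ ψ').resLE V _ hS' := by
    apply ext_of_isAffine
    simp only [Scheme.Hom.appTop, Scheme.Hom.resLE_app_top, happ]
  rw [← Scheme.Hom.resLE_comp_ι _ hS, key, Scheme.Hom.resLE_comp_ι]

/-- **Agreement on `V(J)` from congruences of sections, global form**: if every point of `U`
has an affine neighbourhood `W` mapped by `ψ` and `ψ'` into a common affine open `V` of `X`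
with `ψ^*s - ψ'^*s ∈ J(W)` for all `s ∈ Γ(X, V)`, then `ψ` and `ψ'` agree on the closed
subscheme `V(J)` (`J.subschemeι ≫ ψ = J.subschemeι ≫ ψ'`, the hypothesis of Thm. 3.97 in the
tree, `Kollar2007.centreSeq_eq_of_etaleEquivalent`). [cite: Kollar2007, Def. 3.96 (2) (p. 165)] -/
theorem subschemeι_comp_eq_of_forall_sub_mem
    (h : ∀ u : U, ∃ (V : X.affineOpens) (W : U.affineOpens)
      (hW : (W : U.Opens) ≤ ψ ⁻¹ᵁ (V : X.Opens)) (hW' : (W : U.Opens) ≤ ψ' ⁻¹ᵁ (V : X.Opens)),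
      u ∈ (W : U.Opens) ∧ ∀ s : Γ(X, V), ψ.appLE V W hW s - ψ'.appLE V W hW' s ∈ J.ideal W) :
    J.subschemeι ≫ ψ = J.subschemeι ≫ ψ' := by
  apply Scheme.hom_ext_of_forall
  intro v
  obtain ⟨V, W, hW, hW', huW, hcong⟩ := h (J.subschemeι v)
  exact ⟨J.subschemeι ⁻¹ᵁ (W : U.Opens), huW,
    ι_subschemeι_comp_eq_of_forall_sub_mem J V W hW hW' hcong⟩

/-- **Membership in a quasi-coherent ideal is local on stalks**: a section `a ∈ Γ(X, U)` over an
affine open whose germs lie in the stalks `J_x` at all `x ∈ U` lies in `J(U)` (the stalks are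
the localizations of `Γ(X, U)` at its primes). [folklore] -/
theorem mem_ideal_of_forall_germ_mem {Y : Scheme.{u}} (K : Y.IdealSheafData) (T : Y.affineOpens)
    (a : Γ(Y, T)) (h : ∀ (y : Y) (hy : y ∈ (T : Y.Opens)), Y.presheaf.germ T y hy a ∈ stalkIdeal K y) :
    a ∈ K.ideal T := by
  refine Ideal.mem_of_localization_maximal fun P hP => ?_
  haveI := hP.isPrime
  let q : PrimeSpectrum Γ(Y, T) := ⟨P, hP.isPrime⟩
  have hy : T.2.fromSpec q ∈ (T : Y.Opens) := T.2.range_fromSpec.le ⟨q, rfl⟩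
  letI : Algebra Γ(Y, T) (Y.presheaf.stalk (T.2.fromSpec q)) :=
    (Y.presheaf.germ T (T.2.fromSpec q) hy).hom.toAlgebra
  haveI : IsLocalization.AtPrime (Y.presheaf.stalk (T.2.fromSpec q)) P :=
    T.2.isLocalization_stalk' q hy
  let e : Localization.AtPrime P ≃ₐ[Γ(Y, T)] Y.presheaf.stalk (T.2.fromSpec q) :=
    IsLocalization.algEquiv P.primeCompl _ _
  have key := h _ hy
  rw [stalkIdeal_eq_map_germ K T hy] at key
  have key' : e.symm.toAlgHom.toRingHom (Y.presheaf.germ T _ hy a) ∈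
      ((K.ideal T).map (Y.presheaf.germ T (T.2.fromSpec q) hy).hom).map e.symm.toAlgHom.toRingHom :=
    Ideal.mem_map_of_mem _ key
  rw [Ideal.map_map] at key'
  have hcomp : e.symm.toAlgHom.toRingHom.comp (Y.presheaf.germ T (T.2.fromSpec q) hy).hom =
      algebraMap Γ(Y, T) (Localization.AtPrime P) :=
    RingHom.ext fun a => e.symm.commutes a
  rw [hcomp] at key'
  have ha : e.symm.toAlgHom.toRingHom (Y.presheaf.germ T _ hy a) = algebraMap _ _ a :=
    e.symm.commutes a
  rwa [ha] at key'

/-- **From stalkwise to sectionwise congruence**: if the germs satisfy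
`(ψ^*s - ψ'^*s)_u ∈ J_u` at every point `u` of the affine open `W`, then
`ψ^*s - ψ'^*s ∈ J(W)` — the form in which Thm. 3.92 delivers (4′)
(`KollarEtaleNeighbourhood.lean`: "`ψ^*(h) - ψ'^*(h) ∈ (ψ'^*B)_u`").
[cite: Kollar2007, Def. 3.91 (4′) (p. 162)] -/
theorem appLE_sub_appLE_mem_of_forall_germ (V : X.Opens) (W : U.affineOpens)
    (hW : (W : U.Opens) ≤ ψ ⁻¹ᵁ V) (hW' : (W : U.Opens) ≤ ψ' ⁻¹ᵁ V) (s : Γ(X, V))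
    (h : ∀ (u : U) (hu : u ∈ (W : U.Opens)),
      U.presheaf.germ W u hu (ψ.appLE V W hW s - ψ'.appLE V W hW' s) ∈ stalkIdeal J u) :
    ψ.appLE V W hW s - ψ'.appLE V W hW' s ∈ J.ideal W :=
  mem_ideal_of_forall_germ_mem J W _ h

end Literature.AlgebraicGeometry.Resolution

end
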